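import Summits.AtomisticToContinuum.HydrodynamicLimit.Theorems.InformationPercolationEngineKickFairRelEquilibriumMesoTransferKey
import HarnessLib

/-!
# `KickFairRelEquilibriumMeso`, line `Sketch` — stub R-ii″ `stub_restartConcentrationCut` SPLIT BY THE WINDOW POSITION
# (crux stmt-AtomisticToContinuum-15177; `--supports`; worker R2-scout of the continuation lead c2, 2026-08-16)

Helper file of the line `Cruxes/KickFairRelEquilibriumMeso/Lines/Sketch.lean` (rev 9). The registered open stub R-ii″
(speed-`N` concentration of the CUT windowed `κ`-centred kick sum under the invariant law pinched at a level set of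
the time-zero key, uniformly over kinetic windows `(t₁, t₂] ⊆ [0, τ]` of length `≤ t_N`) is the conjunction of two
statements of DIFFERENT mathematical classes, and this file machine-checks that the split is exact:

* FIRST WINDOW (`t₁ = 0`, `t₂ ≤ t_N`): the law of the window is the time-zero pinched invariant law `G_B = G(· | B)`
  itself — a cellwise (count, binned momentum, binned energy)-conditioned low-density hard-sphere Gibbs measure run
  for at most `t_N ≍ 7σ²` mean free times (sub-critical collision forest). EQUILIBRIUM-CONCENTRATION class: by the
  key-tilt identity `G(· | B) = G*(· | B)` for every `G* ∝ e^{F(key)}·G` and a local CLT for the cellwise-constant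
  local Gibbs law `G*` matched to `B` (`G*(B) ≥ e^{-O((N+1)^{3/4} log N)}`), it reduces to an UNCONDITIONED speed-`N`
  upper deviation bound under cellwise-constant local Gibbs laws, whose nearest print is the dynamical cluster
  expansion of Bodineau–Gallagher–Saint-Raymond–Simonella (Ann. Math. 198 (2023), Thm 3–4; Boltzmann–Grad, times a
  fraction of the mean free time, single-trajectory functionals).
* EVOLVED WINDOWS (`0 < t₁ ≤ τ`): the law of the window is the EVOLVED pinched law `G_B ∘ Φ_{-t₁}`, up to
  `≍ 7σ²τ(N+1)^{1/3}` mean free times after the pinch; equivalently (invariance of `G`) an equilibrium two-time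
  large-deviation decorrelation `G(B ∩ Φ_{t₁}⁻¹E) ≤ e^{-c(N+1)} G(B)` between a coarse time-zero event of `G`-mass
  `e^{-Θ(N)}` and a forward kick-deviation event. ONE-SIDED-CHAOS (Boltzmann-hypothesis) class: no bounded-difference,
  transportation or cluster-expansion argument in the initial coordinates reaches it (chaotic amplification over
  `(0, t₁]`; the collision forest is supercritical by the factor `N^{1/3}`).

`restartConcentrationCut_of_firstWindow_of_evolved` glues the two halves into the registered signature VERBATIM
(case `t₁ = 0 ∨ 0 < t₁`; `σ₀ = min`, `c = min`, `η = min`, `N₀ = max`, monotonicity of the two exponential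
thresholds); `firstWindow_of_restartConcentrationCut` and `evolved_of_restartConcentrationCut` are the converse
specialisations, so nothing is lost. All hypotheses are explicit binders (no named `Prop` is taken as a fact); the
named forms `RestartConcentrationFirstWindow` / `RestartConcentrationEvolved` live in the lead's scratch file
`work/stubs/R2_scratch.lean` with the memo `work/stubs/R2-scout.md` (mechanism census with costs, literature gaps).
The two halves write the level set as `keyLevel N z₀` (`…MesoTransferKey`, definitionally
`{z | cellKey (rs N) (rs N) z = cellKey (rs N) (rs N) z₀}`); the conclusion is the registered signature byte for byte.
-/

noncomputable section

open MeasureTheory Set Filter Topology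
open scoped ENNReal Classical

namespace Summit.AtomisticToContinuum.HydrodynamicLimit.Theorems.KickFairRelEquilibriumMesoLine

open Literature.Analysis.FluidPDE Literature.MathematicalPhysics.KineticTheory

/-- **Stub R-ii″ from its two halves (registered sub-goal `restartConcentrationCut_of_firstWindow_of_evolved`).**
If the cut restart concentration holds for the FIRST kinetic window (`t₁ = 0`, `t₂ ≤ t_N`: first hypothesis) and for
the EVOLVED windows (`0 < t₁`: second hypothesis), then it holds for all kinetic windows `(t₁, t₂] ⊆ [0, τ]` of length
`≤ t_N`, i.e. the registered signature of `Holds.stub_restartConcentrationCut` (line `Sketch`, rev 9) verbatim: take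
`σ₀ = min σ₁ σ₂`, `c = min c₁ c₂`, `η = min η₁ η₂`, `N₀ = max N₁ N₂`, split on `t₁ = 0 ∨ 0 < t₁`, and use
`e^{-η(N+1)} ≥ e^{-ηᵢ(N+1)}`, `e^{-cᵢ(N+1)} ≤ e^{-c(N+1)}`. [folklore] -/
theorem restartConcentrationCut_of_firstWindow_of_evolved :
    (∀ (a₀ θ₀ : T3 → ℝ) (u₀ : T3 → V3), Continuous a₀ → Continuous θ₀ → Continuous u₀ →
      (∀ x, 0 < a₀ x) → (∀ x, 0 < θ₀ x) →
      ∃ σ₀ : ℝ, 0 < σ₀ ∧ ∀ σ : ℝ, 0 < σ → σ < σ₀ → ∀ Φ : (N : ℕ) → Flow σ N, ∀ τ : ℝ, 0 < τ →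
      ∀ g : V3 × V3 × V3 → ℝ, Continuous g → (∃ C : ℝ, ∀ p, |g p| ≤ C) →
      ∀ L : ℝ, 0 < L → ∀ A : ℝ, 0 < A →
      ∃ c : ℝ, 0 < c ∧ ∃ η : ℝ, 0 < η ∧ ∃ N₀ : ℕ, ∀ N : ℕ, N₀ ≤ N →
      ∀ h : Fin (N + 1) → ℕ → Past N → ℝ, (∀ i n, Measurable (h i n)) → (∀ i n p, |h i n p| ≤ 1) →
      (∀ i n p, p.2.2.2 - p.2.1 < tN N / A → h i n p = 0) →
      ∀ t₂ : ℝ, 0 ≤ t₂ → t₂ ≤ τ → t₂ ≤ tN N →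
      ∀ z₀ : Phase N,
      ENNReal.ofReal (Real.exp (-(η * ((N : ℝ) + 1)))) ≤ localGibbsLaw σ a₀ u₀ θ₀ N (Φ N) (keyLevel N z₀) →
        localGibbsLaw σ (fun _ => 1) (fun _ => 0) (fun _ => 1) N (Φ N)
            (keyLevel N z₀ ∩
              {z | tN N / L < |slotSum (Φ N) τ (rs N) 0 t₂ g h z -
                (localGibbsLaw σ (fun _ => 1) (fun _ => 0) (fun _ => 1) N (Φ N) (keyLevel N z₀)).toReal⁻¹ *
                  ∫ z in keyLevel N z₀, slotSum (Φ N) τ (rs N) 0 t₂ g h z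
                    ∂(localGibbsLaw σ (fun _ => 1) (fun _ => 0) (fun _ => 1) N (Φ N))|}) ≤
          ENNReal.ofReal (Real.exp (-(c * ((N : ℝ) + 1)))) *
            localGibbsLaw σ (fun _ => 1) (fun _ => 0) (fun _ => 1) N (Φ N) (keyLevel N z₀)) →
    (∀ (a₀ θ₀ : T3 → ℝ) (u₀ : T3 → V3), Continuous a₀ → Continuous θ₀ → Continuous u₀ →
      (∀ x, 0 < a₀ x) → (∀ x, 0 < θ₀ x) →
      ∃ σ₀ : ℝ, 0 < σ₀ ∧ ∀ σ : ℝ, 0 < σ → σ < σ₀ → ∀ Φ : (N : ℕ) → Flow σ N, ∀ τ : ℝ, 0 < τ →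
      ∀ g : V3 × V3 × V3 → ℝ, Continuous g → (∃ C : ℝ, ∀ p, |g p| ≤ C) →
      ∀ L : ℝ, 0 < L → ∀ A : ℝ, 0 < A →
      ∃ c : ℝ, 0 < c ∧ ∃ η : ℝ, 0 < η ∧ ∃ N₀ : ℕ, ∀ N : ℕ, N₀ ≤ N →
      ∀ h : Fin (N + 1) → ℕ → Past N → ℝ, (∀ i n, Measurable (h i n)) → (∀ i n p, |h i n p| ≤ 1) →
      (∀ i n p, p.2.2.2 - p.2.1 < tN N / A → h i n p = 0) →
      ∀ t₁ t₂ : ℝ, 0 < t₁ → t₁ ≤ t₂ → t₂ ≤ τ → t₂ ≤ t₁ + tN N →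
      ∀ z₀ : Phase N,
      ENNReal.ofReal (Real.exp (-(η * ((N : ℝ) + 1)))) ≤ localGibbsLaw σ a₀ u₀ θ₀ N (Φ N) (keyLevel N z₀) →
        localGibbsLaw σ (fun _ => 1) (fun _ => 0) (fun _ => 1) N (Φ N)
            (keyLevel N z₀ ∩
              {z | tN N / L < |slotSum (Φ N) τ (rs N) t₁ t₂ g h z -
                (localGibbsLaw σ (fun _ => 1) (fun _ => 0) (fun _ => 1) N (Φ N) (keyLevel N z₀)).toReal⁻¹ *
                  ∫ z in keyLevel N z₀, slotSum (Φ N) τ (rs N) t₁ t₂ g h z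
                    ∂(localGibbsLaw σ (fun _ => 1) (fun _ => 0) (fun _ => 1) N (Φ N))|}) ≤
          ENNReal.ofReal (Real.exp (-(c * ((N : ℝ) + 1)))) *
            localGibbsLaw σ (fun _ => 1) (fun _ => 0) (fun _ => 1) N (Φ N) (keyLevel N z₀)) →
    ∀ (a₀ θ₀ : T3 → ℝ) (u₀ : T3 → V3), Continuous a₀ → Continuous θ₀ → Continuous u₀ →
    (∀ x, 0 < a₀ x) → (∀ x, 0 < θ₀ x) →
    ∃ σ₀ : ℝ, 0 < σ₀ ∧ ∀ σ : ℝ, 0 < σ → σ < σ₀ → ∀ Φ : (N : ℕ) → Flow σ N, ∀ τ : ℝ, 0 < τ →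
    ∀ g : V3 × V3 × V3 → ℝ, Continuous g → (∃ C : ℝ, ∀ p, |g p| ≤ C) →
    ∀ L : ℝ, 0 < L → ∀ A : ℝ, 0 < A →
    ∃ c : ℝ, 0 < c ∧ ∃ η : ℝ, 0 < η ∧ ∃ N₀ : ℕ, ∀ N : ℕ, N₀ ≤ N →
    ∀ h : Fin (N + 1) → ℕ → Past N → ℝ, (∀ i n, Measurable (h i n)) → (∀ i n p, |h i n p| ≤ 1) →
    (∀ i n p, p.2.2.2 - p.2.1 < tN N / A → h i n p = 0) →
    ∀ t₁ t₂ : ℝ, 0 ≤ t₁ → t₁ ≤ t₂ → t₂ ≤ τ → t₂ ≤ t₁ + tN N →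
    ∀ z₀ : Phase N,
    ENNReal.ofReal (Real.exp (-(η * ((N : ℝ) + 1)))) ≤
        localGibbsLaw σ a₀ u₀ θ₀ N (Φ N) {z | cellKey (rs N) (rs N) z = cellKey (rs N) (rs N) z₀} →
      localGibbsLaw σ (fun _ => 1) (fun _ => 0) (fun _ => 1) N (Φ N)
          ({z | cellKey (rs N) (rs N) z = cellKey (rs N) (rs N) z₀} ∩
            {z | tN N / L < |slotSum (Φ N) τ (rs N) t₁ t₂ g h z -
              (localGibbsLaw σ (fun _ => 1) (fun _ => 0) (fun _ => 1) N (Φ N)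
                  {z | cellKey (rs N) (rs N) z = cellKey (rs N) (rs N) z₀}).toReal⁻¹ *
                ∫ z in {z | cellKey (rs N) (rs N) z = cellKey (rs N) (rs N) z₀}, slotSum (Φ N) τ (rs N) t₁ t₂ g h z
                  ∂(localGibbsLaw σ (fun _ => 1) (fun _ => 0) (fun _ => 1) N (Φ N))|}) ≤
        ENNReal.ofReal (Real.exp (-(c * ((N : ℝ) + 1)))) *
          localGibbsLaw σ (fun _ => 1) (fun _ => 0) (fun _ => 1) N (Φ N)
            {z | cellKey (rs N) (rs N) z = cellKey (rs N) (rs N) z₀} := by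
  intro H₁ H₂ a₀ θ₀ u₀ ha hθ hu ha0 hθ0
  obtain ⟨σ₁, hσ₁, H₁⟩ := H₁ a₀ θ₀ u₀ ha hθ hu ha0 hθ0
  obtain ⟨σ₂, hσ₂, H₂⟩ := H₂ a₀ θ₀ u₀ ha hθ hu ha0 hθ0
  refine ⟨min σ₁ σ₂, lt_min hσ₁ hσ₂, fun σ hσ hσlt Φ τ hτ g hg hgb L hL A hA => ?_⟩
  obtain ⟨c₁, hc₁, η₁, hη₁, N₁, H₁⟩ :=
    H₁ σ hσ (hσlt.trans_le (min_le_left _ _)) Φ τ hτ g hg hgb L hL A hA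
  obtain ⟨c₂, hc₂, η₂, hη₂, N₂, H₂⟩ :=
    H₂ σ hσ (hσlt.trans_le (min_le_right _ _)) Φ τ hτ g hg hgb L hL A hA
  refine ⟨min c₁ c₂, lt_min hc₁ hc₂, min η₁ η₂, lt_min hη₁ hη₂, max N₁ N₂,
    fun N hN h hh hhb hcut t₁ t₂ ht₁ h12 ht₂τ hlen z₀ hB => ?_⟩
  have hN0 : (0 : ℝ) ≤ (N : ℝ) + 1 := by positivity
  -- monotonicity of the two exponential thresholds
  have hfloor : ∀ η' : ℝ, min η₁ η₂ ≤ η' →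
      ENNReal.ofReal (Real.exp (-(η' * ((N : ℝ) + 1)))) ≤ localGibbsLaw σ a₀ u₀ θ₀ N (Φ N) (keyLevel N z₀) := by
    intro η' hη'
    refine le_trans (ENNReal.ofReal_le_ofReal (Real.exp_le_exp.2 ?_)) hB
    nlinarith [mul_le_mul_of_nonneg_right hη' hN0]
  have hrate : ∀ c' : ℝ, min c₁ c₂ ≤ c' →
      ENNReal.ofReal (Real.exp (-(c' * ((N : ℝ) + 1)))) ≤
        ENNReal.ofReal (Real.exp (-(min c₁ c₂ * ((N : ℝ) + 1)))) := by
    intro c' hc'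
    refine ENNReal.ofReal_le_ofReal (Real.exp_le_exp.2 ?_)
    nlinarith [mul_le_mul_of_nonneg_right hc' hN0]
  rcases ht₁.eq_or_lt with h0 | hpos
  · subst h0
    have key := H₁ N (le_trans (le_max_left _ _) hN) h hh hhb hcut t₂ h12 ht₂τ (by simpa using hlen) z₀
      (hfloor η₁ (min_le_left _ _))
    exact key.trans (mul_le_mul_left (hrate c₁ (min_le_left _ _)) _)
  · have key := H₂ N (le_trans (le_max_right _ _) hN) h hh hhb hcut t₁ t₂ hpos h12 ht₂τ hlen z₀
      (hfloor η₂ (min_le_right _ _))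
    exact key.trans (mul_le_mul_left (hrate c₂ (min_le_right _ _)) _)

/-- **The first-window half is a special case of stub R-ii″** (`t₁ = 0`; the split loses nothing). [folklore] -/
theorem firstWindow_of_restartConcentrationCut :
    (∀ (a₀ θ₀ : T3 → ℝ) (u₀ : T3 → V3), Continuous a₀ → Continuous θ₀ → Continuous u₀ →
      (∀ x, 0 < a₀ x) → (∀ x, 0 < θ₀ x) →
      ∃ σ₀ : ℝ, 0 < σ₀ ∧ ∀ σ : ℝ, 0 < σ → σ < σ₀ → ∀ Φ : (N : ℕ) → Flow σ N, ∀ τ : ℝ, 0 < τ →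
      ∀ g : V3 × V3 × V3 → ℝ, Continuous g → (∃ C : ℝ, ∀ p, |g p| ≤ C) →
      ∀ L : ℝ, 0 < L → ∀ A : ℝ, 0 < A →
      ∃ c : ℝ, 0 < c ∧ ∃ η : ℝ, 0 < η ∧ ∃ N₀ : ℕ, ∀ N : ℕ, N₀ ≤ N →
      ∀ h : Fin (N + 1) → ℕ → Past N → ℝ, (∀ i n, Measurable (h i n)) → (∀ i n p, |h i n p| ≤ 1) →
      (∀ i n p, p.2.2.2 - p.2.1 < tN N / A → h i n p = 0) →
      ∀ t₁ t₂ : ℝ, 0 ≤ t₁ → t₁ ≤ t₂ → t₂ ≤ τ → t₂ ≤ t₁ + tN N →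
      ∀ z₀ : Phase N,
      ENNReal.ofReal (Real.exp (-(η * ((N : ℝ) + 1)))) ≤
          localGibbsLaw σ a₀ u₀ θ₀ N (Φ N) {z | cellKey (rs N) (rs N) z = cellKey (rs N) (rs N) z₀} →
        localGibbsLaw σ (fun _ => 1) (fun _ => 0) (fun _ => 1) N (Φ N)
            ({z | cellKey (rs N) (rs N) z = cellKey (rs N) (rs N) z₀} ∩
              {z | tN N / L < |slotSum (Φ N) τ (rs N) t₁ t₂ g h z -
                (localGibbsLaw σ (fun _ => 1) (fun _ => 0) (fun _ => 1) N (Φ N)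
                    {z | cellKey (rs N) (rs N) z = cellKey (rs N) (rs N) z₀}).toReal⁻¹ *
                  ∫ z in {z | cellKey (rs N) (rs N) z = cellKey (rs N) (rs N) z₀}, slotSum (Φ N) τ (rs N) t₁ t₂ g h z
                    ∂(localGibbsLaw σ (fun _ => 1) (fun _ => 0) (fun _ => 1) N (Φ N))|}) ≤
          ENNReal.ofReal (Real.exp (-(c * ((N : ℝ) + 1)))) *
            localGibbsLaw σ (fun _ => 1) (fun _ => 0) (fun _ => 1) N (Φ N)
              {z | cellKey (rs N) (rs N) z = cellKey (rs N) (rs N) z₀}) →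
    ∀ (a₀ θ₀ : T3 → ℝ) (u₀ : T3 → V3), Continuous a₀ → Continuous θ₀ → Continuous u₀ →
    (∀ x, 0 < a₀ x) → (∀ x, 0 < θ₀ x) →
    ∃ σ₀ : ℝ, 0 < σ₀ ∧ ∀ σ : ℝ, 0 < σ → σ < σ₀ → ∀ Φ : (N : ℕ) → Flow σ N, ∀ τ : ℝ, 0 < τ →
    ∀ g : V3 × V3 × V3 → ℝ, Continuous g → (∃ C : ℝ, ∀ p, |g p| ≤ C) →
    ∀ L : ℝ, 0 < L → ∀ A : ℝ, 0 < A →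
    ∃ c : ℝ, 0 < c ∧ ∃ η : ℝ, 0 < η ∧ ∃ N₀ : ℕ, ∀ N : ℕ, N₀ ≤ N →
    ∀ h : Fin (N + 1) → ℕ → Past N → ℝ, (∀ i n, Measurable (h i n)) → (∀ i n p, |h i n p| ≤ 1) →
    (∀ i n p, p.2.2.2 - p.2.1 < tN N / A → h i n p = 0) →
    ∀ t₂ : ℝ, 0 ≤ t₂ → t₂ ≤ τ → t₂ ≤ tN N →
    ∀ z₀ : Phase N,
    ENNReal.ofReal (Real.exp (-(η * ((N : ℝ) + 1)))) ≤ localGibbsLaw σ a₀ u₀ θ₀ N (Φ N) (keyLevel N z₀) →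
      localGibbsLaw σ (fun _ => 1) (fun _ => 0) (fun _ => 1) N (Φ N)
          (keyLevel N z₀ ∩
            {z | tN N / L < |slotSum (Φ N) τ (rs N) 0 t₂ g h z -
              (localGibbsLaw σ (fun _ => 1) (fun _ => 0) (fun _ => 1) N (Φ N) (keyLevel N z₀)).toReal⁻¹ *
                ∫ z in keyLevel N z₀, slotSum (Φ N) τ (rs N) 0 t₂ g h z
                  ∂(localGibbsLaw σ (fun _ => 1) (fun _ => 0) (fun _ => 1) N (Φ N))|}) ≤
        ENNReal.ofReal (Real.exp (-(c * ((N : ℝ) + 1)))) *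
          localGibbsLaw σ (fun _ => 1) (fun _ => 0) (fun _ => 1) N (Φ N) (keyLevel N z₀) := by
  intro H a₀ θ₀ u₀ ha hθ hu ha0 hθ0
  obtain ⟨σ₀, hσ₀, H⟩ := H a₀ θ₀ u₀ ha hθ hu ha0 hθ0
  refine ⟨σ₀, hσ₀, fun σ hσ hσlt Φ τ hτ g hg hgb L hL A hA => ?_⟩
  obtain ⟨c, hc, η, hη, N₀, H⟩ := H σ hσ hσlt Φ τ hτ g hg hgb L hL A hA
  refine ⟨c, hc, η, hη, N₀, fun N hN h hh hhb hcut t₂ ht₂ ht₂τ ht₂N z₀ hB => ?_⟩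
  exact H N hN h hh hhb hcut 0 t₂ le_rfl ht₂ ht₂τ (by simpa using ht₂N) z₀ hB

/-- **The evolved half is a special case of stub R-ii″** (`0 < t₁` weakened to `0 ≤ t₁`). [folklore] -/
theorem evolved_of_restartConcentrationCut :
    (∀ (a₀ θ₀ : T3 → ℝ) (u₀ : T3 → V3), Continuous a₀ → Continuous θ₀ → Continuous u₀ →
      (∀ x, 0 < a₀ x) → (∀ x, 0 < θ₀ x) →
      ∃ σ₀ : ℝ, 0 < σ₀ ∧ ∀ σ : ℝ, 0 < σ → σ < σ₀ → ∀ Φ : (N : ℕ) → Flow σ N, ∀ τ : ℝ, 0 < τ →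
      ∀ g : V3 × V3 × V3 → ℝ, Continuous g → (∃ C : ℝ, ∀ p, |g p| ≤ C) →
      ∀ L : ℝ, 0 < L → ∀ A : ℝ, 0 < A →
      ∃ c : ℝ, 0 < c ∧ ∃ η : ℝ, 0 < η ∧ ∃ N₀ : ℕ, ∀ N : ℕ, N₀ ≤ N →
      ∀ h : Fin (N + 1) → ℕ → Past N → ℝ, (∀ i n, Measurable (h i n)) → (∀ i n p, |h i n p| ≤ 1) →
      (∀ i n p, p.2.2.2 - p.2.1 < tN N / A → h i n p = 0) →
      ∀ t₁ t₂ : ℝ, 0 ≤ t₁ → t₁ ≤ t₂ → t₂ ≤ τ → t₂ ≤ t₁ + tN N →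
      ∀ z₀ : Phase N,
      ENNReal.ofReal (Real.exp (-(η * ((N : ℝ) + 1)))) ≤
          localGibbsLaw σ a₀ u₀ θ₀ N (Φ N) {z | cellKey (rs N) (rs N) z = cellKey (rs N) (rs N) z₀} →
        localGibbsLaw σ (fun _ => 1) (fun _ => 0) (fun _ => 1) N (Φ N)
            ({z | cellKey (rs N) (rs N) z = cellKey (rs N) (rs N) z₀} ∩
              {z | tN N / L < |slotSum (Φ N) τ (rs N) t₁ t₂ g h z -
                (localGibbsLaw σ (fun _ => 1) (fun _ => 0) (fun _ => 1) N (Φ N)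
                    {z | cellKey (rs N) (rs N) z = cellKey (rs N) (rs N) z₀}).toReal⁻¹ *
                  ∫ z in {z | cellKey (rs N) (rs N) z = cellKey (rs N) (rs N) z₀}, slotSum (Φ N) τ (rs N) t₁ t₂ g h z
                    ∂(localGibbsLaw σ (fun _ => 1) (fun _ => 0) (fun _ => 1) N (Φ N))|}) ≤
          ENNReal.ofReal (Real.exp (-(c * ((N : ℝ) + 1)))) *
            localGibbsLaw σ (fun _ => 1) (fun _ => 0) (fun _ => 1) N (Φ N)
              {z | cellKey (rs N) (rs N) z = cellKey (rs N) (rs N) z₀}) →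
    ∀ (a₀ θ₀ : T3 → ℝ) (u₀ : T3 → V3), Continuous a₀ → Continuous θ₀ → Continuous u₀ →
    (∀ x, 0 < a₀ x) → (∀ x, 0 < θ₀ x) →
    ∃ σ₀ : ℝ, 0 < σ₀ ∧ ∀ σ : ℝ, 0 < σ → σ < σ₀ → ∀ Φ : (N : ℕ) → Flow σ N, ∀ τ : ℝ, 0 < τ →
    ∀ g : V3 × V3 × V3 → ℝ, Continuous g → (∃ C : ℝ, ∀ p, |g p| ≤ C) →
    ∀ L : ℝ, 0 < L → ∀ A : ℝ, 0 < A →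
    ∃ c : ℝ, 0 < c ∧ ∃ η : ℝ, 0 < η ∧ ∃ N₀ : ℕ, ∀ N : ℕ, N₀ ≤ N →
    ∀ h : Fin (N + 1) → ℕ → Past N → ℝ, (∀ i n, Measurable (h i n)) → (∀ i n p, |h i n p| ≤ 1) →
    (∀ i n p, p.2.2.2 - p.2.1 < tN N / A → h i n p = 0) →
    ∀ t₁ t₂ : ℝ, 0 < t₁ → t₁ ≤ t₂ → t₂ ≤ τ → t₂ ≤ t₁ + tN N →
    ∀ z₀ : Phase N,
    ENNReal.ofReal (Real.exp (-(η * ((N : ℝ) + 1)))) ≤ localGibbsLaw σ a₀ u₀ θ₀ N (Φ N) (keyLevel N z₀) →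
      localGibbsLaw σ (fun _ => 1) (fun _ => 0) (fun _ => 1) N (Φ N)
          (keyLevel N z₀ ∩
            {z | tN N / L < |slotSum (Φ N) τ (rs N) t₁ t₂ g h z -
              (localGibbsLaw σ (fun _ => 1) (fun _ => 0) (fun _ => 1) N (Φ N) (keyLevel N z₀)).toReal⁻¹ *
                ∫ z in keyLevel N z₀, slotSum (Φ N) τ (rs N) t₁ t₂ g h z
                  ∂(localGibbsLaw σ (fun _ => 1) (fun _ => 0) (fun _ => 1) N (Φ N))|}) ≤
        ENNReal.ofReal (Real.exp (-(c * ((N : ℝ) + 1)))) *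
          localGibbsLaw σ (fun _ => 1) (fun _ => 0) (fun _ => 1) N (Φ N) (keyLevel N z₀) := by
  intro H a₀ θ₀ u₀ ha hθ hu ha0 hθ0
  obtain ⟨σ₀, hσ₀, H⟩ := H a₀ θ₀ u₀ ha hθ hu ha0 hθ0
  refine ⟨σ₀, hσ₀, fun σ hσ hσlt Φ τ hτ g hg hgb L hL A hA => ?_⟩
  obtain ⟨c, hc, η, hη, N₀, H⟩ := H σ hσ hσlt Φ τ hτ g hg hgb L hL A hA
  refine ⟨c, hc, η, hη, N₀, fun N hN h hh hhb hcut t₁ t₂ ht₁ h12 ht₂τ hlen z₀ hB => ?_⟩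
  exact H N hN h hh hhb hcut t₁ t₂ ht₁.le h12 ht₂τ hlen z₀ hB

end Summit.AtomisticToContinuum.HydrodynamicLimit.Theorems.KickFairRelEquilibriumMesoLine

end
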